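import Summits.HodgeConjecture.HodgeConjecture.Theorems.F0LD1ArchTorusHom
import Literature.RepresentationTheory.CompactGroups.TorusWeightSpaces
import Literature.RepresentationTheory.FiniteGroups.CharacterDegrees
import HarnessLib

/-!
# (Gβ2-iii′) The full-torus character projector EXTRACTS ONE HERMITE COMPONENT of a theta class with arbitrary archimedean datum
# (line LD1 of crux HLiu418, organ (Gβ) «theta slice», LD1-plan (g2) DEALS #6 (1))

Cell hodgecm-mathlib, floor 0; namespace `Summit.HodgeConjecture.HodgeConjecture.Cruxes.HLiu418.F0LD1ThetaClassTorusExtraction`; seat LD1-p02 (g3);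
`--supports stmt-HodgeConjecture-24832 --as helper`.  THEOREMS ONLY (no definition, no instance, no notation, no `sorry`).

Binders = ★ (Gβ2-ii-α) `F0LD1ArchTorusHom` §3's: a hom `k : T_∞ →* U(H)(𝔸)`, `T_∞ = ({v real} → Fin N → Circle)`, with the `mulSingle` pin through the transport `ιA`;
Borel data and a probability Haar measure `μT` on `T_∞` (§0 `exists_borel_haarProbability` supplies them, ∃-packaged); a one-dimensional continuous unitary `κ`
of `T_∞` with `κ z 1 = c_β(z) := ∏_v ∏_p z_{v,p}^{n_{v,p}(β)}` (the ★ eigencharacter of the Hermite class `[θ_{h_β ⊗ Φ_f}]`); orbit-continuity `hU` and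
unitarity `hUu` of `U := (rightRegular ν).restrict k` (the arguments of ★ `Schur.charProjL`); an ARBITRARY archimedean Schwartz datum `Φ` with a Folland–Hermite
expansion `hsum : HasSum (γ ↦ coeff γ • h_γ) Φ` in `𝓢`; and the continuity `hcont` of the class map `Ψ ↦ [θ_{Ψ ⊗ Φ_f}]` (brick (Gβ2-i), a hypothesis here).
* §0 `prod_prod_zpow_injective` (the characters `z ↦ ∏∏ z_{i,j}^{m_{i,j}}` of a double torus are pairwise distinct), `exists_borel_haarProbability`.
* §1 `hasSum_thetaClass_of_hasSum` — the class map is additive (★ `toLp_lineThetaLift_add_left`∕`_smul_left`) and continuous, so `hsum` passes to `L²`: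
  `HasSum (γ ↦ coeff γ • [θ_{h_γ ⊗ Φ_f}]) [θ_{Φ ⊗ Φ_f}]`.
* §2 `charProj_thetaClass_follandHermite_eq_zero_of_ne` — the projector of type `c_β` KILLS `[θ_{h_γ ⊗ Φ_f}]` for `γ ≠ β` (★ α §3 `…_eq_zero_of_torusPin` against the
  character representation `σ_γ = c_γ • 1`, one-dimensional hence irreducible ★ `isIrreducible_of_finrank_eq_one`; `σ_γ ≇ κ` since equivalent one-dimensional
  representations have equal characters and `γ ↦ c_γ` is injective — §0 and ★ `CircleChar.zpow_injective'`, the exponents `n_{v,p}(γ)` determine `γ(e₁(p,0), v)`).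
* §3 **`charProjL_thetaClass_eq_coeff_smul_of_torusPin`: `Schur.charProjL μT κ U … [θ_{Φ ⊗ Φ_f}] = coeff β • [θ_{h_β ⊗ Φ_f}]`** (`charProjL` is a CLM; termwise §2 and ★ α
  `…_eq_self_of_torusPin`; a series with one non-zero term: `hasSum_ite_eq`, `HasSum.unique`).
Nothing printed is discharged.  HC_CM is proved only modulo the 7 printed citations (2 remaining: hLiu418 = stmt-HodgeConjecture-24832, h413 =
stmt-HodgeConjecture-24833) until rung 0 closes.

References (prose locators): Bröcker–tom Dieck 1985 I (5.12) (Haar on compact groups), II (8.1) (characters of tori), III (5.10) (character projectors);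
Konno–Konno 2007 Thm 5.4; Folland 1989 §1.7 (Hermite expansions); Borel–Jacquet 1979 §4.6.
-/

set_option autoImplicit false
set_option linter.dupNamespace false

noncomputable section

open NumberField NumberField.InfinitePlace NumberField.mixedEmbedding MeasureTheory IsDedekindDomain
open scoped Matrix ComplexOrder ENNReal TensorProduct SchwartzMap Kronecker Classical ComplexConjugate InnerProductSpace

namespace Summit.HodgeConjecture.HodgeConjecture.Cruxes.HLiu418.F0LD1ThetaClassTorusExtraction


open _root_.MeasureTheory
open Literature.NumberTheory.Automorphic Literature.NumberTheory.Automorphic.UnitaryGroup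
open Literature.NumberTheory.Automorphic.UnitaryGroup.CotangentForms
open Literature.NumberTheory.Automorphic.IdeleClassGroup
open Literature.NumberTheory.Automorphic.Liu2021
open Literature.NumberTheory.Automorphic.Liu2021.Def411WeilCarriers
open Literature.NumberTheory.Automorphic.Liu2021.Def411WeilCarriersDoubling
open Literature.NumberTheory.Automorphic.Liu2021.CinfThetaTorus
open Literature.NumberTheory.GelbartRogawski1991 Literature.NumberTheory.GelbartRogawski1991.UnitaryDualPair
open Literature.NumberTheory.GelbartRogawski1991.GRConstruction
open Literature.NumberTheory.Weil1964
open Literature.RepresentationTheory.Liu2021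
open Literature.RepresentationTheory.HeisenbergGroup Literature.Analysis.SegalBargmann
open Literature.RepresentationTheory.KonnoKonno2007 Literature.RepresentationTheory.KonnoKonno2007.RealDualPair
open Literature.RepresentationTheory.CompactGroups
open Summit.HodgeConjecture.HodgeConjecture.Cruxes.HLiu418.F0LD1ThetaTransportKit
open Summit.HodgeConjecture.HodgeConjecture.Cruxes.HLiu418.F0LD2ThetaTensorClasses
open Summit.HodgeConjecture.HodgeConjecture.Cruxes.HLiu418.F0LD2ThetaTorusEigenclass


variable (L : Type) [Field L] [NumberField L] [IsCMField L] (N : ℕ) (H : Matrix (Fin N) (Fin N) L)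
  {n' : ℕ} (e₁ : Fin N × Fin 1 ≃ Fin n') (dV : Fin N → L) (hdV : ∀ i, IsCMField.complexConj L (dV i) = dV i)
open Summit.HodgeConjecture.HodgeConjecture.Cruxes.HLiu418.F0LD1ArchTorusHom
open Literature.RepresentationTheory.CompactGroups.TorusWeights (prod_zpow_mulSingle)
open Literature.RepresentationTheory.FiniteGroups (isIrreducible_of_finrank_eq_one)

/-! ## §0 Generic: torus characters are injective in the exponents; Borel data and Haar probability on the torus -/

/-- **The characters `z ↦ ∏_i ∏_j z_{i,j}^{m_{i,j}}` of the double torus `(S¹)^{ι × κ}` are pairwise distinct** (evaluate at the coordinate circles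
`mulSingle i (mulSingle j ζ)`; ★ `CircleChar.zpow_injective'`). [cite: BrockerTomDieck1985, II (8.1)] -/
theorem prod_prod_zpow_injective {ι κ : Type} [Fintype ι] [Fintype κ] [DecidableEq ι] [DecidableEq κ] {m m' : ι → κ → ℤ}
    (h : ∀ z : ι → κ → Circle, (∏ i, ∏ j, (((z i j : Circle) : ℂ)) ^ m i j) = ∏ i, ∏ j, (((z i j : Circle) : ℂ)) ^ m' i j) :
    m = m' := by
  funext i j
  have key : ∀ n : ι → κ → ℤ, ∀ ζ : Circle,
      (∏ i', ∏ j', (((Pi.mulSingle i (Pi.mulSingle j ζ) : ι → κ → Circle) i' j' : Circle) : ℂ) ^ n i' j') = ((ζ : Circle) : ℂ) ^ n i j := by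
    intro n ζ
    rw [Finset.prod_eq_single i]
    · rw [Pi.mulSingle_eq_same, prod_zpow_mulSingle (n i) j ζ]
    · intro i' _ hi'
      rw [Pi.mulSingle_eq_of_ne hi']
      simp only [Pi.one_apply, Circle.coe_one, one_zpow, Finset.prod_const_one]
    · intro hi
      exact absurd (Finset.mem_univ i) hi
  refine Literature.RepresentationTheory.CompactGroups.CircleChar.zpow_injective' fun ζ => ?_
  have hz := h (Pi.mulSingle i (Pi.mulSingle j ζ))
  rw [key, key] at hz
  ext
  rw [Circle.coe_zpow, Circle.coe_zpow, hz]

/-- **Borel data and a probability Haar measure on the compact torus `T_∞ = ({v real} → Fin N → Circle)`** (Mathlib `borel`, `haarMeasure ⊤`), ∃-packaged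
for the junction (`obtain ⟨_, _, μT, _, _⟩ := …`; no instance is declared in this file). [cite: BrockerTomDieck1985, I (5.12)] -/
theorem exists_borel_haarProbability (L : Type) [Field L] [NumberField L] (N : ℕ) :
    ∃ (_ : MeasurableSpace (({v : InfinitePlace (↥(maximalRealSubfield L)) // v.IsReal}) → Fin N → Circle)) (_ : BorelSpace (({v : InfinitePlace (↥(maximalRealSubfield L)) // v.IsReal}) → Fin N → Circle)) (μT : Measure (({v : InfinitePlace (↥(maximalRealSubfield L)) // v.IsReal}) → Fin N → Circle)),
      IsProbabilityMeasure μT ∧ μT.IsMulLeftInvariant := by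
  letI : MeasurableSpace (({v : InfinitePlace (↥(maximalRealSubfield L)) // v.IsReal}) → Fin N → Circle) := borel _
  haveI : BorelSpace (({v : InfinitePlace (↥(maximalRealSubfield L)) // v.IsReal}) → Fin N → Circle) := ⟨rfl⟩
  exact ⟨inferInstance, inferInstance, Measure.haarMeasure ⊤, ⟨by rw [← TopologicalSpace.PositiveCompacts.coe_top]; exact Measure.haarMeasure_self⟩,
    inferInstance⟩


variable (L : Type) [Field L] [NumberField L] [IsCMField L] (N : ℕ) (H : Matrix (Fin N) (Fin N) L)
  {n' : ℕ} (e₁ : Fin N × Fin 1 ≃ Fin n') (dV : Fin N → L) (hdV : ∀ i, IsCMField.complexConj L (dV i) = dV i)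
  (hdV0 : ∀ i, dV i ≠ 0)
  (ιA : (adelicGroupData (↥(maximalRealSubfield L)) L (IsCMField.complexConj L) N H).Adelic →*
    ↥(UnitaryGroup.adelic (↥(maximalRealSubfield L)) L (IsCMField.complexConj L) N (Matrix.diagonal dV)))
  (hιA : Continuous ιA ∧ ∀ ⦃γ : (adelicGroupData (↥(maximalRealSubfield L)) L (IsCMField.complexConj L) N H).Adelic⦄,
    γ ∈ (UnitaryGroup.toAdelic (↥(maximalRealSubfield L)) L (IsCMField.complexConj L) N H).range →
      ιA γ ∈ (UnitaryGroup.toAdelic (↥(maximalRealSubfield L)) L (IsCMField.complexConj L) N (Matrix.diagonal dV)).range)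
  (μ : Literature.NumberTheory.Automorphic.IdeleClassGroup L →ₜ* Circle) (hμ : IsConjugateSymplectic L μ) (a : (↥(maximalRealSubfield L))ˣ)
  (hρ : HasThetaMajorants fun
      (p : ↥(UnitaryGroup.adelic (↥(maximalRealSubfield L)) L (IsCMField.complexConj L) N (Matrix.diagonal dV)) ×
        ↥(UnitaryGroup.adelic (↥(maximalRealSubfield L)) L (IsCMField.complexConj L) 1 (JW (↥(maximalRealSubfield L)) L a)))
      (Φ : piSchwartzBruhat (↥(maximalRealSubfield L)) (Fin n')) =>
        pairRep (↥(maximalRealSubfield L)) L (IsCMField.complexConj L) N 1 e₁ (Matrix.diagonal dV) (JW (↥(maximalRealSubfield L)) L a)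
          (chiSplittingLine L e₁ dV hdV hdV0 (toHeckeCharacter L μ) (isUnitary_toHeckeCharacter L μ)
            ((isOscillatorChar_toHeckeCharacter_iff μ).mpr hμ) (TW (↥(maximalRealSubfield L)) a)
            (isUnit_det_TW (↥(maximalRealSubfield L)) a) (JW (↥(maximalRealSubfield L)) L a) (JW_eq (↥(maximalRealSubfield L)) L a))
          p Φ)
  [CompactSpace (↥(UnitaryGroup.adelic (↥(maximalRealSubfield L)) L (IsCMField.complexConj L) N (Matrix.diagonal dV)) ⧸
    (UnitaryGroup.toAdelic (↥(maximalRealSubfield L)) L (IsCMField.complexConj L) N (Matrix.diagonal dV)).range)]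
  [MeasurableSpace (↥(UnitaryGroup.adelic (↥(maximalRealSubfield L)) L (IsCMField.complexConj L) 1 (JW (↥(maximalRealSubfield L)) L a)) ⧸
    (UnitaryGroup.toAdelic (↥(maximalRealSubfield L)) L (IsCMField.complexConj L) 1 (JW (↥(maximalRealSubfield L)) L a)).range)]
  (μW : Measure (↥(UnitaryGroup.adelic (↥(maximalRealSubfield L)) L (IsCMField.complexConj L) 1 (JW (↥(maximalRealSubfield L)) L a)) ⧸
    (UnitaryGroup.toAdelic (↥(maximalRealSubfield L)) L (IsCMField.complexConj L) 1 (JW (↥(maximalRealSubfield L)) L a)).range))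
  (f : C((↥(UnitaryGroup.adelic (↥(maximalRealSubfield L)) L (IsCMField.complexConj L) 1 (JW (↥(maximalRealSubfield L)) L a)) ⧸
    (UnitaryGroup.toAdelic (↥(maximalRealSubfield L)) L (IsCMField.complexConj L) 1 (JW (↥(maximalRealSubfield L)) L a)).range), ℂ))
  [BorelSpace (↥(UnitaryGroup.adelic (↥(maximalRealSubfield L)) L (IsCMField.complexConj L) 1 (JW (↥(maximalRealSubfield L)) L a)) ⧸
    (UnitaryGroup.toAdelic (↥(maximalRealSubfield L)) L (IsCMField.complexConj L) 1 (JW (↥(maximalRealSubfield L)) L a)).range)]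
  [IsFiniteMeasure μW]
  [CompactSpace (adelicGroupData (↥(maximalRealSubfield L)) L (IsCMField.complexConj L) N H).automorphicQuotient]
  (ν : Measure (adelicGroupData (↥(maximalRealSubfield L)) L (IsCMField.complexConj L) N H).automorphicQuotient) [IsFiniteMeasure ν]
  [SMulInvariantMeasure (adelicGroupData (↥(maximalRealSubfield L)) L (IsCMField.complexConj L) N H).Adelic
    (adelicGroupData (↥(maximalRealSubfield L)) L (IsCMField.complexConj L) N H).automorphicQuotient ν]


include hιA

/-! ## §1 The Hermite expansion passes to the theta classes -/

omit [SMulInvariantMeasure (adelicGroupData (↥(maximalRealSubfield L)) L (IsCMField.complexConj L) N H).Adelic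
  (adelicGroupData (↥(maximalRealSubfield L)) L (IsCMField.complexConj L) N H).automorphicQuotient ν] in
set_option maxHeartbeats 400000 in
/-- **§1 The class map pushes a Schwartz expansion to `L²`**: if `Φ = Σ_γ coeff γ • h_γ` (`HasSum` in `𝓢`) and `Ψ ↦ [θ_{Ψ ⊗ Φ_f}]` is continuous, then
`HasSum (γ ↦ coeff γ • [θ_{h_γ ⊗ Φ_f}]) [θ_{Φ ⊗ Φ_f}]` (the class map is additive and homogeneous ★ `toLp_lineThetaLift_add_left` ∕ `_smul_left`; Mathlib
`HasSum.map`). [cite: Folland1989, §1.7] [cite: Weil1964, Chap. III n° 41 Thm 6 p. 193] -/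
theorem hasSum_thetaClass_of_hasSum
    (Φf : FinSB (↥(maximalRealSubfield L)) (Fin n'))
    (Φ : 𝓢((Fin n' → mixedSpace (↥(maximalRealSubfield L))), ℂ)) {ι : Type} (h : ι → 𝓢((Fin n' → mixedSpace (↥(maximalRealSubfield L))), ℂ)) (coeff : ι → ℂ)
    (hsum : HasSum (fun γ => coeff γ • h γ) Φ)
    (hcont : Continuous fun Ψ : 𝓢((Fin n' → mixedSpace (↥(maximalRealSubfield L))), ℂ) =>
      (MemLp.toLp _ (memLp_toQuotFun_lineThetaLift L N H e₁ dV hdV hdV0 ιA hιA μ hμ a hρ μW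
          (piSchwartzBruhatEquiv (↥(maximalRealSubfield L)) (Fin n') (Ψ ⊗ₜ Φf)) f ν 2))) :
    HasSum (fun γ => coeff γ •
        (MemLp.toLp _ (memLp_toQuotFun_lineThetaLift L N H e₁ dV hdV hdV0 ιA hιA μ hμ a hρ μW
          (piSchwartzBruhatEquiv (↥(maximalRealSubfield L)) (Fin n') (h γ ⊗ₜ Φf)) f ν 2)))
      (MemLp.toLp _ (memLp_toQuotFun_lineThetaLift L N H e₁ dV hdV hdV0 ιA hιA μ hμ a hρ μW
          (piSchwartzBruhatEquiv (↥(maximalRealSubfield L)) (Fin n') (Φ ⊗ₜ Φf)) f ν 2)) := by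
  have hadd : ∀ Ψ₁ Ψ₂ : 𝓢((Fin n' → mixedSpace (↥(maximalRealSubfield L))), ℂ),
      (MemLp.toLp _ (memLp_toQuotFun_lineThetaLift L N H e₁ dV hdV hdV0 ιA hιA μ hμ a hρ μW
          (piSchwartzBruhatEquiv (↥(maximalRealSubfield L)) (Fin n') ((Ψ₁ + Ψ₂) ⊗ₜ Φf)) f ν 2)) =
        (MemLp.toLp _ (memLp_toQuotFun_lineThetaLift L N H e₁ dV hdV hdV0 ιA hιA μ hμ a hρ μW
          (piSchwartzBruhatEquiv (↥(maximalRealSubfield L)) (Fin n') (Ψ₁ ⊗ₜ Φf)) f ν 2)) +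
          (MemLp.toLp _ (memLp_toQuotFun_lineThetaLift L N H e₁ dV hdV hdV0 ιA hιA μ hμ a hρ μW
          (piSchwartzBruhatEquiv (↥(maximalRealSubfield L)) (Fin n') (Ψ₂ ⊗ₜ Φf)) f ν 2)) := fun Ψ₁ Ψ₂ => by
    rw [TensorProduct.add_tmul, map_add]
    exact toLp_lineThetaLift_add_left L N H e₁ dV hdV hdV0 ιA hιA μ hμ a hρ μW f ν _ _
  have hsmul : ∀ (c : ℂ) (Ψ : 𝓢((Fin n' → mixedSpace (↥(maximalRealSubfield L))), ℂ)),
      (MemLp.toLp _ (memLp_toQuotFun_lineThetaLift L N H e₁ dV hdV hdV0 ιA hιA μ hμ a hρ μW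
          (piSchwartzBruhatEquiv (↥(maximalRealSubfield L)) (Fin n') ((c • Ψ) ⊗ₜ Φf)) f ν 2)) =
        c • (MemLp.toLp _ (memLp_toQuotFun_lineThetaLift L N H e₁ dV hdV hdV0 ιA hιA μ hμ a hρ μW
          (piSchwartzBruhatEquiv (↥(maximalRealSubfield L)) (Fin n') (Ψ ⊗ₜ Φf)) f ν 2)) := fun c Ψ => by
    rw [← TensorProduct.smul_tmul', map_smul]
    exact toLp_lineThetaLift_smul_left L N H e₁ dV hdV hdV0 ιA hιA μ hμ a hρ μW f ν _ _
  have hmap := hsum.map (AddMonoidHom.mk' (fun Ψ : 𝓢((Fin n' → mixedSpace (↥(maximalRealSubfield L))), ℂ) =>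
    (MemLp.toLp _ (memLp_toQuotFun_lineThetaLift L N H e₁ dV hdV hdV0 ιA hιA μ hμ a hρ μW
          (piSchwartzBruhatEquiv (↥(maximalRealSubfield L)) (Fin n') (Ψ ⊗ₜ Φf)) f ν 2))) hadd) hcont
  have hfun : ((AddMonoidHom.mk' (fun Ψ : 𝓢((Fin n' → mixedSpace (↥(maximalRealSubfield L))), ℂ) =>
      (MemLp.toLp _ (memLp_toQuotFun_lineThetaLift L N H e₁ dV hdV hdV0 ιA hιA μ hμ a hρ μW
          (piSchwartzBruhatEquiv (↥(maximalRealSubfield L)) (Fin n') (Ψ ⊗ₜ Φf)) f ν 2))) hadd : 𝓢((Fin n' → mixedSpace (↥(maximalRealSubfield L))), ℂ) → Lp ℂ 2 ν) ∘ fun γ => coeff γ • h γ) =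
      fun γ => coeff γ •
        (MemLp.toLp _ (memLp_toQuotFun_lineThetaLift L N H e₁ dV hdV hdV0 ιA hιA μ hμ a hρ μW
          (piSchwartzBruhatEquiv (↥(maximalRealSubfield L)) (Fin n') (h γ ⊗ₜ Φf)) f ν 2)) :=
    funext fun γ => hsmul (coeff γ) (h γ)
  rw [hfun] at hmap
  exact hmap

/-! ## §2 The projector of type `c_β` kills the other Hermite classes -/

set_option maxHeartbeats 400000 in
/-- **§2 `P_{c_β} [θ_{h_γ ⊗ Φ_f}] = 0` for `γ ≠ β`**: the Hermite class of index `γ` is an eigenvector of character `c_γ` (★ α §2), `c_γ ≠ c_β` as characters of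
`T_∞` (§0: the exponents `n_{v,p}` determine the multi-index at fixed signs), so the one-dimensional representation `σ_γ = c_γ • 1` is irreducible and NOT
equivalent to `κ` (equivalent one-dimensional representations have equal characters); ★ α §3 `charProj_thetaClass_follandHermite_eq_zero_of_torusPin`.
[cite: BrockerTomDieck1985, III (5.10); II (4.6); II (8.1)] [cite: KonnoKonno2007, Thm. 5.4] -/
theorem charProj_thetaClass_follandHermite_eq_zero_of_ne
    {τ : InfinitePlace L → ℤ} (hτ : (toHeckeCharacter L μ).HasUnitaryArchType τ 0) (hodd : ∀ w, Odd (τ w))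
    (β γ : (Fin n' × {v : InfinitePlace (↥(maximalRealSubfield L)) // v.IsReal}) →₀ ℕ) (hγ : γ ≠ β) (Φf : FinSB (↥(maximalRealSubfield L)) (Fin n'))
    (k : (({v : InfinitePlace (↥(maximalRealSubfield L)) // v.IsReal}) → Fin N → Circle) →*
      (adelicGroupData (↥(maximalRealSubfield L)) L (IsCMField.complexConj L) N H).Adelic)
    (hk : ∀ (v : {v : InfinitePlace (↥(maximalRealSubfield L)) // v.IsReal}) (x : Fin N → Circle),
      ιA (k (Pi.mulSingle v x)) = UnitaryGroup.adelicSingle (↥(maximalRealSubfield L)) L (IsCMField.complexConj L) N (Matrix.diagonal dV)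
        (IsCMField.complexConj_ne_one L) (complexConj_smul_infinitePlace L) (cmPlaceOver L v)
        ⟨circleDiagonal N x, circleDiagonal_mem_archLocal_diagonal L N dV (cmPlaceOver L v) x⟩)
    [MeasurableSpace (({v : InfinitePlace (↥(maximalRealSubfield L)) // v.IsReal}) → Fin N → Circle)] [BorelSpace (({v : InfinitePlace (↥(maximalRealSubfield L)) // v.IsReal}) → Fin N → Circle)]
    (μT : Measure (({v : InfinitePlace (↥(maximalRealSubfield L)) // v.IsReal}) → Fin N → Circle)) [IsProbabilityMeasure μT] [μT.IsMulLeftInvariant]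
    {κ : ContRepresentation ℂ (({v : InfinitePlace (↥(maximalRealSubfield L)) // v.IsReal}) → Fin N → Circle) ℂ}
    (hκ : Continuous (κ : (({v : InfinitePlace (↥(maximalRealSubfield L)) // v.IsReal}) → Fin N → Circle) → ℂ →L[ℂ] ℂ)) [κ.toRepresentation.IsIrreducible]
    (hκu : ∀ (g : (({v : InfinitePlace (↥(maximalRealSubfield L)) // v.IsReal}) → Fin N → Circle)) (x y : ℂ), ⟪κ g x, κ g y⟫_ℂ = ⟪x, y⟫_ℂ)
    (hκc : ∀ z, κ z 1 = (∏ v : {v : InfinitePlace (↥(maximalRealSubfield L)) // v.IsReal}, ∏ p : Fin N, (((z v p : Circle) : ℂ)) ^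
        (if 0 < signVec (cmPlaceOver L) (cmGramEntry L e₁ dV hdV (lineW L (TW (Fp L) a)) (complexConj_lineW L (TW (Fp L) a))) (imagUnit L) v (e₁ (p, 0))
          then (τ (cmPlaceOver L v).1 + 1) / 2 + β (e₁ (p, 0), v)
          else (τ (cmPlaceOver L v).1 + 1) / 2 - 1 - β (e₁ (p, 0), v)))) :
    Schur.charProj μT κ (((adelicGroupData (↥(maximalRealSubfield L)) L (IsCMField.complexConj L) N H).rightRegular ν).restrict k)
        (MemLp.toLp _ (memLp_toQuotFun_lineThetaLift L N H e₁ dV hdV hdV0 ιA hιA μ hμ a hρ μW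
          (piSchwartzBruhatEquiv (↥(maximalRealSubfield L)) (Fin n') (follandHermite (frameV L e₁ dV hdV hdV0 (lineW L (TW (Fp L) a)) (complexConj_lineW L (TW (Fp L) a))
              (lineW_ne_zero L (TW (Fp L) a) (isUnit_det_TW (Fp L) a))) γ ⊗ₜ Φf)) f ν 2)) = 0 := by
  -- the character `c_γ` as a hom `T_∞ →* ℂ` and as a one-dimensional representation `σ`
  let χ : (({v : InfinitePlace (↥(maximalRealSubfield L)) // v.IsReal}) → Fin N → Circle) →* ℂ :=
    { toFun := fun z => (∏ v : {v : InfinitePlace (↥(maximalRealSubfield L)) // v.IsReal}, ∏ p : Fin N, (((z v p : Circle) : ℂ)) ^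
        (if 0 < signVec (cmPlaceOver L) (cmGramEntry L e₁ dV hdV (lineW L (TW (Fp L) a)) (complexConj_lineW L (TW (Fp L) a))) (imagUnit L) v (e₁ (p, 0))
          then (τ (cmPlaceOver L v).1 + 1) / 2 + γ (e₁ (p, 0), v)
          else (τ (cmPlaceOver L v).1 + 1) / 2 - 1 - γ (e₁ (p, 0), v)))
      map_one' := by simp only [Pi.one_apply, Circle.coe_one, one_zpow, Finset.prod_const_one]
      map_mul' := fun z z' => by simp only [Pi.mul_apply, Circle.coe_mul, mul_zpow, Finset.prod_mul_distrib] }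
  have hχ : ∀ z, χ z = (∏ v : {v : InfinitePlace (↥(maximalRealSubfield L)) // v.IsReal}, ∏ p : Fin N, (((z v p : Circle) : ℂ)) ^
        (if 0 < signVec (cmPlaceOver L) (cmGramEntry L e₁ dV hdV (lineW L (TW (Fp L) a)) (complexConj_lineW L (TW (Fp L) a))) (imagUnit L) v (e₁ (p, 0))
          then (τ (cmPlaceOver L v).1 + 1) / 2 + γ (e₁ (p, 0), v)
          else (τ (cmPlaceOver L v).1 + 1) / 2 - 1 - γ (e₁ (p, 0), v))) := fun z => rfl
  have hχcont : Continuous χ :=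
    continuous_finsetProd _ fun v _ => continuous_finsetProd _ fun p _ =>
      (continuous_subtype_val.comp ((continuous_apply p).comp (continuous_apply v))).zpow₀ _ fun z => Or.inl (Circle.coe_ne_zero _)
  let σ : ContRepresentation ℂ (({v : InfinitePlace (↥(maximalRealSubfield L)) // v.IsReal}) → Fin N → Circle) ℂ := ContRepresentation.ofMonoidHom ((algebraMap ℂ (ℂ →L[ℂ] ℂ)).toMonoidHom.comp χ)
  have hσapply : ∀ z x, σ z x = χ z * x := fun z x => by
    show (algebraMap ℂ (ℂ →L[ℂ] ℂ) (χ z)) x = χ z * x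
    rw [Algebra.algebraMap_eq_smul_one, _root_.smul_apply, one_apply_eq_self, smul_eq_mul]
  have hσcont : Continuous (σ : (({v : InfinitePlace (↥(maximalRealSubfield L)) // v.IsReal}) → Fin N → Circle) → ℂ →L[ℂ] ℂ) := by
    show Continuous fun z => algebraMap ℂ (ℂ →L[ℂ] ℂ) (χ z)
    exact (continuous_algebraMap ℂ (ℂ →L[ℂ] ℂ)).comp hχcont
  haveI : σ.toRepresentation.IsIrreducible := isIrreducible_of_finrank_eq_one _ (Module.finrank_self ℂ)
  have hσc : ∀ z, σ z 1 = (∏ v : {v : InfinitePlace (↥(maximalRealSubfield L)) // v.IsReal}, ∏ p : Fin N, (((z v p : Circle) : ℂ)) ^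
        (if 0 < signVec (cmPlaceOver L) (cmGramEntry L e₁ dV hdV (lineW L (TW (Fp L) a)) (complexConj_lineW L (TW (Fp L) a))) (imagUnit L) v (e₁ (p, 0))
          then (τ (cmPlaceOver L v).1 + 1) / 2 + γ (e₁ (p, 0), v)
          else (τ (cmPlaceOver L v).1 + 1) / 2 - 1 - γ (e₁ (p, 0), v))) := fun z => by
    rw [hσapply, mul_one]
    exact hχ z
  -- `κ ≇ σ`: an equivalence would force `c_β = c_γ`, hence `β = γ`
  have hne : IsEmpty (κ.toRepresentation.Equiv σ.toRepresentation) := by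
    refine ⟨fun e => hγ ?_⟩
    have h10 : e (1 : ℂ) ≠ 0 := fun h => one_ne_zero ((map_eq_zero_iff e (EquivLike.injective e)).1 h)
    have hchar : ∀ z, κ z 1 = χ z := fun z => by
      have hint : e (κ z 1) = σ z (e 1) := Representation.IntertwiningMap.isIntertwining _ _ e.toIntertwiningMap z 1
      have h2 : e (κ z 1) = κ z 1 * e 1 := by
        rw [← smul_eq_mul, ← map_smul, smul_eq_mul, mul_one]
      rw [h2, hσapply] at hint
      exact mul_right_cancel₀ h10 hint
    have hm := prod_prod_zpow_injective (m := (fun (v : {v : InfinitePlace (↥(maximalRealSubfield L)) // v.IsReal}) (p : Fin N) =>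
        (if 0 < signVec (cmPlaceOver L) (cmGramEntry L e₁ dV hdV (lineW L (TW (Fp L) a)) (complexConj_lineW L (TW (Fp L) a))) (imagUnit L) v (e₁ (p, 0))
          then (τ (cmPlaceOver L v).1 + 1) / 2 + (β (e₁ (p, 0), v) : ℤ)
          else (τ (cmPlaceOver L v).1 + 1) / 2 - 1 - (β (e₁ (p, 0), v) : ℤ))))
      (m' := (fun (v : {v : InfinitePlace (↥(maximalRealSubfield L)) // v.IsReal}) (p : Fin N) =>
        (if 0 < signVec (cmPlaceOver L) (cmGramEntry L e₁ dV hdV (lineW L (TW (Fp L) a)) (complexConj_lineW L (TW (Fp L) a))) (imagUnit L) v (e₁ (p, 0))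
          then (τ (cmPlaceOver L v).1 + 1) / 2 + (γ (e₁ (p, 0), v) : ℤ)
          else (τ (cmPlaceOver L v).1 + 1) / 2 - 1 - (γ (e₁ (p, 0), v) : ℤ)))) fun z => by
        have h := hκc z
        rw [hchar z, hχ] at h
        exact h.symm
    refine Finsupp.ext fun iv => ?_
    obtain ⟨i, v⟩ := iv
    have hi : e₁ ((e₁.symm i).1, 0) = i := by
      rw [show ((e₁.symm i).1, (0 : Fin 1)) = e₁.symm i from Prod.ext rfl (Subsingleton.elim _ _), Equiv.apply_symm_apply]
    have h := congr_fun (congr_fun hm v) (e₁.symm i).1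
    simp only [hi] at h
    split_ifs at h <;> omega
  exact charProj_thetaClass_follandHermite_eq_zero_of_torusPin L N H e₁ dV hdV hdV0 ιA hιA μ hμ a hρ μW f ν hτ hodd γ Φf k hk μT hκ hσcont hne hκu hσc

/-! ## §3 The extraction -/

set_option maxHeartbeats 400000 in
/-- **(Gβ2-iii′) THE FULL-TORUS CHARACTER PROJECTOR EXTRACTS ONE HERMITE COMPONENT.**  With `U := (rightRegular ν).restrict k` for a torus hom `k` with the
`mulSingle` pin (★ `F0LD1ArchTorusHom`), a one-dimensional continuous unitary `κ` of type `c_β`, an archimedean datum `Φ = Σ_γ coeff γ • h_γ` (`HasSum` in `𝓢`,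
Folland–Hermite functions of the line frame) and the class map `Ψ ↦ [θ_{Ψ ⊗ Φ_f}]` continuous:
`Schur.charProjL μT κ U hκ hκu hU hUu [θ_{Φ ⊗ Φ_f}] = coeff β • [θ_{h_β ⊗ Φ_f}]`.
[cite: BrockerTomDieck1985, III (5.10); II (8.1)] [cite: KonnoKonno2007, Thm. 5.4] [cite: Folland1989, §1.7] -/
theorem charProjL_thetaClass_eq_coeff_smul_of_torusPin
    {τ : InfinitePlace L → ℤ} (hτ : (toHeckeCharacter L μ).HasUnitaryArchType τ 0) (hodd : ∀ w, Odd (τ w))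
    (β : (Fin n' × {v : InfinitePlace (↥(maximalRealSubfield L)) // v.IsReal}) →₀ ℕ) (Φf : FinSB (↥(maximalRealSubfield L)) (Fin n'))
    (k : (({v : InfinitePlace (↥(maximalRealSubfield L)) // v.IsReal}) → Fin N → Circle) →*
      (adelicGroupData (↥(maximalRealSubfield L)) L (IsCMField.complexConj L) N H).Adelic)
    (hk : ∀ (v : {v : InfinitePlace (↥(maximalRealSubfield L)) // v.IsReal}) (x : Fin N → Circle),
      ιA (k (Pi.mulSingle v x)) = UnitaryGroup.adelicSingle (↥(maximalRealSubfield L)) L (IsCMField.complexConj L) N (Matrix.diagonal dV)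
        (IsCMField.complexConj_ne_one L) (complexConj_smul_infinitePlace L) (cmPlaceOver L v)
        ⟨circleDiagonal N x, circleDiagonal_mem_archLocal_diagonal L N dV (cmPlaceOver L v) x⟩)
    [MeasurableSpace (({v : InfinitePlace (↥(maximalRealSubfield L)) // v.IsReal}) → Fin N → Circle)] [BorelSpace (({v : InfinitePlace (↥(maximalRealSubfield L)) // v.IsReal}) → Fin N → Circle)]
    (μT : Measure (({v : InfinitePlace (↥(maximalRealSubfield L)) // v.IsReal}) → Fin N → Circle)) [IsProbabilityMeasure μT] [μT.IsMulLeftInvariant]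
    {κ : ContRepresentation ℂ (({v : InfinitePlace (↥(maximalRealSubfield L)) // v.IsReal}) → Fin N → Circle) ℂ}
    (hκ : Continuous (κ : (({v : InfinitePlace (↥(maximalRealSubfield L)) // v.IsReal}) → Fin N → Circle) → ℂ →L[ℂ] ℂ)) [κ.toRepresentation.IsIrreducible]
    (hκu : ∀ (g : (({v : InfinitePlace (↥(maximalRealSubfield L)) // v.IsReal}) → Fin N → Circle)) (x y : ℂ), ⟪κ g x, κ g y⟫_ℂ = ⟪x, y⟫_ℂ)
    (hκc : ∀ z, κ z 1 = (∏ v : {v : InfinitePlace (↥(maximalRealSubfield L)) // v.IsReal}, ∏ p : Fin N, (((z v p : Circle) : ℂ)) ^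
        (if 0 < signVec (cmPlaceOver L) (cmGramEntry L e₁ dV hdV (lineW L (TW (Fp L) a)) (complexConj_lineW L (TW (Fp L) a))) (imagUnit L) v (e₁ (p, 0))
          then (τ (cmPlaceOver L v).1 + 1) / 2 + β (e₁ (p, 0), v)
          else (τ (cmPlaceOver L v).1 + 1) / 2 - 1 - β (e₁ (p, 0), v))))
    (hU : ∀ w, Continuous fun z : (({v : InfinitePlace (↥(maximalRealSubfield L)) // v.IsReal}) → Fin N → Circle) => (((adelicGroupData (↥(maximalRealSubfield L)) L (IsCMField.complexConj L) N H).rightRegular ν).restrict k) z w)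
    (hUu : ∀ (z : (({v : InfinitePlace (↥(maximalRealSubfield L)) // v.IsReal}) → Fin N → Circle)) (w w' : Lp ℂ 2 ν), ⟪(((adelicGroupData (↥(maximalRealSubfield L)) L (IsCMField.complexConj L) N H).rightRegular ν).restrict k) z w, (((adelicGroupData (↥(maximalRealSubfield L)) L (IsCMField.complexConj L) N H).rightRegular ν).restrict k) z w'⟫_ℂ = ⟪w, w'⟫_ℂ)
    (Φ : 𝓢((Fin n' → mixedSpace (↥(maximalRealSubfield L))), ℂ)) (coeff : ((Fin n' × {v : InfinitePlace (↥(maximalRealSubfield L)) // v.IsReal}) →₀ ℕ) → ℂ)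
    (hsum : HasSum (fun γ => coeff γ • follandHermite (frameV L e₁ dV hdV hdV0 (lineW L (TW (Fp L) a)) (complexConj_lineW L (TW (Fp L) a))
              (lineW_ne_zero L (TW (Fp L) a) (isUnit_det_TW (Fp L) a))) γ) Φ)
    (hcont : Continuous fun Ψ : 𝓢((Fin n' → mixedSpace (↥(maximalRealSubfield L))), ℂ) =>
      (MemLp.toLp _ (memLp_toQuotFun_lineThetaLift L N H e₁ dV hdV hdV0 ιA hιA μ hμ a hρ μW
          (piSchwartzBruhatEquiv (↥(maximalRealSubfield L)) (Fin n') (Ψ ⊗ₜ Φf)) f ν 2))) :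
    Schur.charProjL μT κ (((adelicGroupData (↥(maximalRealSubfield L)) L (IsCMField.complexConj L) N H).rightRegular ν).restrict k) hκ hκu hU hUu
        (MemLp.toLp _ (memLp_toQuotFun_lineThetaLift L N H e₁ dV hdV hdV0 ιA hιA μ hμ a hρ μW
          (piSchwartzBruhatEquiv (↥(maximalRealSubfield L)) (Fin n') (Φ ⊗ₜ Φf)) f ν 2)) =
      coeff β • (MemLp.toLp _ (memLp_toQuotFun_lineThetaLift L N H e₁ dV hdV hdV0 ιA hιA μ hμ a hρ μW
          (piSchwartzBruhatEquiv (↥(maximalRealSubfield L)) (Fin n') (follandHermite (frameV L e₁ dV hdV hdV0 (lineW L (TW (Fp L) a)) (complexConj_lineW L (TW (Fp L) a))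
              (lineW_ne_zero L (TW (Fp L) a) (isUnit_det_TW (Fp L) a))) β ⊗ₜ Φf)) f ν 2)) := by
  -- the expansion in `L²`, pushed through the bounded projector
  have h1 := (Schur.charProjL μT κ (((adelicGroupData (↥(maximalRealSubfield L)) L (IsCMField.complexConj L) N H).rightRegular ν).restrict k) hκ hκu hU hUu).hasSum
    (hasSum_thetaClass_of_hasSum L N H e₁ dV hdV hdV0 ιA hιA μ hμ a hρ μW f ν Φf Φ (fun γ => follandHermite (frameV L e₁ dV hdV hdV0 (lineW L (TW (Fp L) a)) (complexConj_lineW L (TW (Fp L) a))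
              (lineW_ne_zero L (TW (Fp L) a) (isUnit_det_TW (Fp L) a))) γ) coeff hsum hcont)
  -- termwise: keep `γ = β`, kill `γ ≠ β`
  have hfun : (fun γ : (Fin n' × {v : InfinitePlace (↥(maximalRealSubfield L)) // v.IsReal}) →₀ ℕ => Schur.charProjL μT κ (((adelicGroupData (↥(maximalRealSubfield L)) L (IsCMField.complexConj L) N H).rightRegular ν).restrict k) hκ hκu hU hUu
      (coeff γ • (MemLp.toLp _ (memLp_toQuotFun_lineThetaLift L N H e₁ dV hdV hdV0 ιA hιA μ hμ a hρ μW
          (piSchwartzBruhatEquiv (↥(maximalRealSubfield L)) (Fin n') (follandHermite (frameV L e₁ dV hdV hdV0 (lineW L (TW (Fp L) a)) (complexConj_lineW L (TW (Fp L) a))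
              (lineW_ne_zero L (TW (Fp L) a) (isUnit_det_TW (Fp L) a))) γ ⊗ₜ Φf)) f ν 2)))) =
      fun γ => if γ = β then coeff β • (MemLp.toLp _ (memLp_toQuotFun_lineThetaLift L N H e₁ dV hdV hdV0 ιA hιA μ hμ a hρ μW
          (piSchwartzBruhatEquiv (↥(maximalRealSubfield L)) (Fin n') (follandHermite (frameV L e₁ dV hdV hdV0 (lineW L (TW (Fp L) a)) (complexConj_lineW L (TW (Fp L) a))
              (lineW_ne_zero L (TW (Fp L) a) (isUnit_det_TW (Fp L) a))) β ⊗ₜ Φf)) f ν 2)) else 0 := by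
    funext γ
    rw [map_smul, Schur.charProjL_apply]
    split_ifs with hγ
    · subst hγ
      rw [charProj_thetaClass_follandHermite_eq_self_of_torusPin L N H e₁ dV hdV hdV0 ιA hιA μ hμ a hρ μW f ν hτ hodd γ Φf k hk μT hκ hκu hκc]
    · rw [charProj_thetaClass_follandHermite_eq_zero_of_ne L N H e₁ dV hdV hdV0 ιA hιA μ hμ a hρ μW f ν hτ hodd β γ hγ Φf k hk μT hκ hκu hκc, smul_zero]
  rw [hfun] at h1
  exact h1.unique (hasSum_ite_eq β _)

/-! ## §4 (ED. 2) The extraction from the CLASS-level expansion (the junction's currency: ★ `F0LD1ThetaClassHermiteSum`) -/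

set_option maxHeartbeats 400000 in
/-- **(Gβ2-iii′, class currency) THE EXTRACTION FROM THE `L²` HERMITE EXPANSION OF THE CLASS** — as §3, but the hypothesis is the CLASS-level expansion
`hsum : HasSum (γ ↦ coeff γ • [θ_{h_γ ⊗ Φ_f}]) [θ_{Φ ⊗ Φ_f}]` in `Lp ℂ 2 ν` (★ `F0LD1ThetaClassHermiteSum.hasSum_follandCoeff_smul_thetaClass_follandHermite`), no `hcont`:
`Schur.charProjL μT κ U hκ hκu hU hUu [θ_{Φ ⊗ Φ_f}] = coeff β • [θ_{h_β ⊗ Φ_f}]`. [cite: BrockerTomDieck1985, III (5.10); II (8.1)] [cite: KonnoKonno2007, Thm. 5.4] -/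
theorem charProjL_thetaClass_eq_coeff_smul_of_hasSum_thetaClass
    {τ : InfinitePlace L → ℤ} (hτ : (toHeckeCharacter L μ).HasUnitaryArchType τ 0) (hodd : ∀ w, Odd (τ w))
    (β : (Fin n' × {v : InfinitePlace (↥(maximalRealSubfield L)) // v.IsReal}) →₀ ℕ) (Φf : FinSB (↥(maximalRealSubfield L)) (Fin n'))
    (k : (({v : InfinitePlace (↥(maximalRealSubfield L)) // v.IsReal}) → Fin N → Circle) →*
      (adelicGroupData (↥(maximalRealSubfield L)) L (IsCMField.complexConj L) N H).Adelic)
    (hk : ∀ (v : {v : InfinitePlace (↥(maximalRealSubfield L)) // v.IsReal}) (x : Fin N → Circle),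
      ιA (k (Pi.mulSingle v x)) = UnitaryGroup.adelicSingle (↥(maximalRealSubfield L)) L (IsCMField.complexConj L) N (Matrix.diagonal dV)
        (IsCMField.complexConj_ne_one L) (complexConj_smul_infinitePlace L) (cmPlaceOver L v)
        ⟨circleDiagonal N x, circleDiagonal_mem_archLocal_diagonal L N dV (cmPlaceOver L v) x⟩)
    [MeasurableSpace (({v : InfinitePlace (↥(maximalRealSubfield L)) // v.IsReal}) → Fin N → Circle)] [BorelSpace (({v : InfinitePlace (↥(maximalRealSubfield L)) // v.IsReal}) → Fin N → Circle)]
    (μT : Measure (({v : InfinitePlace (↥(maximalRealSubfield L)) // v.IsReal}) → Fin N → Circle)) [IsProbabilityMeasure μT] [μT.IsMulLeftInvariant]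
    {κ : ContRepresentation ℂ (({v : InfinitePlace (↥(maximalRealSubfield L)) // v.IsReal}) → Fin N → Circle) ℂ}
    (hκ : Continuous (κ : (({v : InfinitePlace (↥(maximalRealSubfield L)) // v.IsReal}) → Fin N → Circle) → ℂ →L[ℂ] ℂ)) [κ.toRepresentation.IsIrreducible]
    (hκu : ∀ (g : (({v : InfinitePlace (↥(maximalRealSubfield L)) // v.IsReal}) → Fin N → Circle)) (x y : ℂ), ⟪κ g x, κ g y⟫_ℂ = ⟪x, y⟫_ℂ)
    (hκc : ∀ z, κ z 1 = (∏ v : {v : InfinitePlace (↥(maximalRealSubfield L)) // v.IsReal}, ∏ p : Fin N, (((z v p : Circle) : ℂ)) ^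
        (if 0 < signVec (cmPlaceOver L) (cmGramEntry L e₁ dV hdV (lineW L (TW (Fp L) a)) (complexConj_lineW L (TW (Fp L) a))) (imagUnit L) v (e₁ (p, 0))
          then (τ (cmPlaceOver L v).1 + 1) / 2 + β (e₁ (p, 0), v)
          else (τ (cmPlaceOver L v).1 + 1) / 2 - 1 - β (e₁ (p, 0), v))))
    (hU : ∀ w, Continuous fun z : (({v : InfinitePlace (↥(maximalRealSubfield L)) // v.IsReal}) → Fin N → Circle) => (((adelicGroupData (↥(maximalRealSubfield L)) L (IsCMField.complexConj L) N H).rightRegular ν).restrict k) z w)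
    (hUu : ∀ (z : (({v : InfinitePlace (↥(maximalRealSubfield L)) // v.IsReal}) → Fin N → Circle)) (w w' : Lp ℂ 2 ν), ⟪(((adelicGroupData (↥(maximalRealSubfield L)) L (IsCMField.complexConj L) N H).rightRegular ν).restrict k) z w, (((adelicGroupData (↥(maximalRealSubfield L)) L (IsCMField.complexConj L) N H).rightRegular ν).restrict k) z w'⟫_ℂ = ⟪w, w'⟫_ℂ)
    (Φ : 𝓢((Fin n' → mixedSpace (↥(maximalRealSubfield L))), ℂ)) (coeff : ((Fin n' × {v : InfinitePlace (↥(maximalRealSubfield L)) // v.IsReal}) →₀ ℕ) → ℂ)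
    (hsum : HasSum (fun γ => coeff γ •
        (MemLp.toLp _ (memLp_toQuotFun_lineThetaLift L N H e₁ dV hdV hdV0 ιA hιA μ hμ a hρ μW
          (piSchwartzBruhatEquiv (↥(maximalRealSubfield L)) (Fin n') (follandHermite (frameV L e₁ dV hdV hdV0 (lineW L (TW (Fp L) a)) (complexConj_lineW L (TW (Fp L) a))
              (lineW_ne_zero L (TW (Fp L) a) (isUnit_det_TW (Fp L) a))) γ ⊗ₜ Φf)) f ν 2)))
      (MemLp.toLp _ (memLp_toQuotFun_lineThetaLift L N H e₁ dV hdV hdV0 ιA hιA μ hμ a hρ μW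
          (piSchwartzBruhatEquiv (↥(maximalRealSubfield L)) (Fin n') (Φ ⊗ₜ Φf)) f ν 2))) :
    Schur.charProjL μT κ (((adelicGroupData (↥(maximalRealSubfield L)) L (IsCMField.complexConj L) N H).rightRegular ν).restrict k) hκ hκu hU hUu
        (MemLp.toLp _ (memLp_toQuotFun_lineThetaLift L N H e₁ dV hdV hdV0 ιA hιA μ hμ a hρ μW
          (piSchwartzBruhatEquiv (↥(maximalRealSubfield L)) (Fin n') (Φ ⊗ₜ Φf)) f ν 2)) =
      coeff β • (MemLp.toLp _ (memLp_toQuotFun_lineThetaLift L N H e₁ dV hdV hdV0 ιA hιA μ hμ a hρ μW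
          (piSchwartzBruhatEquiv (↥(maximalRealSubfield L)) (Fin n') (follandHermite (frameV L e₁ dV hdV hdV0 (lineW L (TW (Fp L) a)) (complexConj_lineW L (TW (Fp L) a))
              (lineW_ne_zero L (TW (Fp L) a) (isUnit_det_TW (Fp L) a))) β ⊗ₜ Φf)) f ν 2)) := by
  have h1 := (Schur.charProjL μT κ (((adelicGroupData (↥(maximalRealSubfield L)) L (IsCMField.complexConj L) N H).rightRegular ν).restrict k) hκ hκu hU hUu).hasSum hsum
  have hfun : (fun γ : (Fin n' × {v : InfinitePlace (↥(maximalRealSubfield L)) // v.IsReal}) →₀ ℕ => Schur.charProjL μT κ (((adelicGroupData (↥(maximalRealSubfield L)) L (IsCMField.complexConj L) N H).rightRegular ν).restrict k) hκ hκu hU hUu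
      (coeff γ • (MemLp.toLp _ (memLp_toQuotFun_lineThetaLift L N H e₁ dV hdV hdV0 ιA hιA μ hμ a hρ μW
          (piSchwartzBruhatEquiv (↥(maximalRealSubfield L)) (Fin n') (follandHermite (frameV L e₁ dV hdV hdV0 (lineW L (TW (Fp L) a)) (complexConj_lineW L (TW (Fp L) a))
              (lineW_ne_zero L (TW (Fp L) a) (isUnit_det_TW (Fp L) a))) γ ⊗ₜ Φf)) f ν 2)))) =
      fun γ => if γ = β then coeff β • (MemLp.toLp _ (memLp_toQuotFun_lineThetaLift L N H e₁ dV hdV hdV0 ιA hιA μ hμ a hρ μW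
          (piSchwartzBruhatEquiv (↥(maximalRealSubfield L)) (Fin n') (follandHermite (frameV L e₁ dV hdV hdV0 (lineW L (TW (Fp L) a)) (complexConj_lineW L (TW (Fp L) a))
              (lineW_ne_zero L (TW (Fp L) a) (isUnit_det_TW (Fp L) a))) β ⊗ₜ Φf)) f ν 2)) else 0 := by
    funext γ
    rw [map_smul, Schur.charProjL_apply]
    split_ifs with hγ
    · subst hγ
      rw [charProj_thetaClass_follandHermite_eq_self_of_torusPin L N H e₁ dV hdV hdV0 ιA hιA μ hμ a hρ μW f ν hτ hodd γ Φf k hk μT hκ hκu hκc]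
    · rw [charProj_thetaClass_follandHermite_eq_zero_of_ne L N H e₁ dV hdV hdV0 ιA hιA μ hμ a hρ μW f ν hτ hodd β γ hγ Φf k hk μT hκ hκu hκc, smul_zero]
  rw [hfun] at h1
  exact h1.unique (hasSum_ite_eq β _)

end Summit.HodgeConjecture.HodgeConjecture.Cruxes.HLiu418.F0LD1ThetaClassTorusExtraction

end
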